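import Summits.Ventures.HSemireg.WeilFrameMukaiPairing
import Summits.Ventures.HSemireg.Mod4LeadingTermSpectrum

/-!
# Venture HSemireg — TABLE R's CARRIER ∕ DESIGN ROWS ON THE REAL CARRIER, LOWER SIDE DEGREES, every `n`: h-parts with leading term
# in codimension `n` (`q_1 = ⋯ = q_{n-1} = 0`, `q_n ≠ 0`; `ch(O_Z)`, `1 − ch(O_Z)`, `r + q_n η_n + s·pt`) have
# `R_m = (m+3)C(2n,m) − 2(m+1)C(n,m)` (`1 ≤ m ≤ n − 1`) and Mukai density `((2 q_0 q_{2n} + (−1)ⁿC(2n,n)q_n² + 2(−1)ⁿt)/(2n)!)·ĥ^{2n}`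

HONEST FRAMING. Part of the Lean index of the computation cell `pub-hsemireg` (seat w3-mod4-1 gen 13, W3 SPECIAL FIBRES;
MOD4-OFFSPLIT §8 TABLE R «carrier and design shapes»: `n = 2` `(1,8,24,8,1)`, `n = 3` `(1,12,57,112,57,12,1)` computed ×2 (codes
A = B), `n = 4` `(1,16,104,304,480,…)` ×1 (kit j179422); §13.19 ∕ 13.21 NET «still not covered: ρ(f) ≥ 3 ∕ carrier-design rows»).
The tree's real carriers and the Literature's Weil-type layer ONLY: no semiregularity map, no Ext group, no `∫`; nothing here says
that HC / HC_CM / HC_AV holds; nothing here is a claim about any explicit variety or cycle; no Literature fact is declared; NO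
definition is introduced. Imports: FILE 20 `WeilFrameMukaiPairing` (and FILE 13 behind it) + the pure matrix file
`Mod4LeadingTermSpectrum` — independent of the unbuilt `Mod4Carrier*` modules and of FILES 15–18 ∕ 22–29.

WHAT IS PROVED, for `A : AbelianVariety ℂ` of dimension `2n`, `φ ≫ φ = -(d • 𝟙 A)`, `d ≥ 1`, `P, Q` the `±i√d`-eigenspaces,
`dim (P ⊓ H^{1,0}) = n`, `h` `K`-symmetric of type `(1,1)` with `ĥ^{2n} ≠ 0`, non-zero `c± ∈ E±`, and ANY coefficient sequence `q`
with `q_m = 0` for `1 ≤ m ≤ n − 1` and `q_n ≠ 0` (the class `x = Σ_{m ≤ 2n} (q_m/m!) ĥ^m + ĉ₊ + ĉ₋` has h-part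
`q_0 + (q_n/n!) ĥⁿ + … + (q_{2n}/(2n)!) ĥ^{2n}`: LEADING TERM IN CODIMENSION `n` — the shapes of §8's first three rows):
* **`finrank_S_leading_deg`** — `dim S_m(x) + 2(m+1)·C(n,m) = (m+3)·C(2n,m)` for `1 ≤ m ≤ n − 1` (`r_m = m + 1` by
  `Mod4.hankel1_rank_leading`, inserted in FILE 13's `finrank_S_weilType_deg`);
* **`proj_mukaiDual_mul_top_leading`** (`n ≥ 1`, pin `(2n)!·(ĉ₊ĉ₋) = t·ĥ^{2n}`) — the degree-`4n` part of `x^∨ · x` is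
  `((2 q_0 q_{2n} + (-1)ⁿ C(2n,n) q_n² + 2(-1)ⁿ t)/(2n)!) · ĥ^{2n}` (`Mod4.mukaiP_leading` in FILE 20's
  `proj_mukaiDual_mul_top_weilType`): «`χ_HRR = D(2rs + (−1)ⁿC(2n,n)q_n²) + (w,w)_χ`» before `∫` — §8's loci `(w,w)_χ = 2Dq_n²`
  are read off this at `n = 2`.
CHECK AGAINST THE COMPUTED ROWS: `n = 2`: `R_1 = 4·4 − 4·2 = 8`; `n = 3`: `R_1 = 4·6 − 4·3 = 12`, `R_2 = 5·15 − 6·3 = 57`;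
`n = 4`: `R_1 = 16`, `R_2 = 5·28 − 6·6 = 104`, `R_3 = 6·56 − 8·4 = 304` — all as printed. NOT treated: the middle degree (the box
locus of `M_f(q)` is design-specific: §8's drops `112 → 110`, `480 → 478/479`) and the upper side degrees (FILE 15's dual theorems,
unbuilt). Everything PROVED, 0 sorry.
References: [BuchweitzFlenner2008HH] Prop. 6.4.4; [vanGeemen1994HodgeAV] 4.9, Lemma 5.2; [MumfordAV1970] §16;
[BourbakiAlgebre1a3] Ch. III §8, §11 no. 9.
-/

noncomputable section

open CliffordAlgebra (contractLeft)
open ExteriorAlgebra (ι)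
open Module CategoryTheory
open Literature.AlgebraicGeometry.Motives Literature.AlgebraicGeometry.HodgeTheory
open Literature.AlgebraicTopology.SingularHomology

namespace Summit.Ventures.HSemireg.WeilFrame

open Summit.Ventures.HSemireg.WedgeBridge Summit.Ventures.HSemireg.WeilCarrier Summit.Ventures.HSemireg.Mod4Carrier
open Summit.Ventures.HSemireg.Wedge.Hankel

section RealCarrier

variable {A : AbelianVariety ℂ}

/-- **TABLE R's carrier ∕ design rows, lower side degrees on the real carrier** (`1 ≤ m ≤ n − 1`): for ANY `q` with `q_m = 0`
(`1 ≤ m ≤ n − 1`) and `q_n ≠ 0` (leading term in codimension `n`; `q_0`, `q_{n+1}`, … free):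
`dim S_m(x) + 2(m+1)·C(n,m) = (m+3)·C(2n,m)` (`r_m = m + 1`). [cite: BuchweitzFlenner2008HH, Prop. 6.4.4]
[cite: vanGeemen1994HodgeAV, 4.9 and Lemma 5.2] -/
theorem finrank_S_leading_deg (hA : IsSmoothProjective A.dim A.X) {n d : ℕ} (hdim : A.dim = n + n) (hd : 0 < d)
    {φ : A ⟶ A} (hφ : φ ≫ φ = -(d • 𝟙 A)) {P Q : Submodule ℂ (complexBetti A.X 1)}
    (hP : P = Module.End.eigenspace (complexBetti.map φ.hom.hom.hom 1).hom (Complex.I * (Real.sqrt d : ℂ)))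
    (hQ : Q = Module.End.eigenspace (complexBetti.map φ.hom.hom.hom 1).hom (-(Complex.I * (Real.sqrt d : ℂ))))
    (hp : finrank ℂ ↥(P ⊓ hodgeOneZero hA) = n) {h : complexBetti A.X 2}
    (hh : complexBetti.map φ.hom.hom.hom 2 h = (d : ℂ) • h) (h11 : IsOfHodgeType A.dim A.X 2 1 1 h)
    (hvol : ((⋀[ℂ]^2 (complexBetti A.X 1)).subtype ((abelianVarietyCohomologyExteriorH1_holds.equiv A 2).symm h)) ^ (n + n) ≠ 0)
    {cP cQ : complexBetti A.X (2 * n)} (hcP : cP ∈ weilClassesPlus A φ n d) (hcP0 : cP ≠ 0)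
    (hcQ : cQ ∈ weilClassesMinus A φ n d) (hcQ0 : cQ ≠ 0)
    {q : ℕ → ℂ} (hq0 : ∀ m, 1 ≤ m → m < n → q m = 0) (hqn : q n ≠ 0) {m : ℕ} (hm1 : 1 ≤ m) (hmn : m + 1 ≤ n) :
    finrank ℂ ↥(S ℂ (hodgeZeroOne hA) m
        ((∑ m ∈ Finset.range (n + n + 1), (q m * ((m.factorial : ℕ) : ℂ)⁻¹) •
            ((⋀[ℂ]^2 (complexBetti A.X 1)).subtype ((abelianVarietyCohomologyExteriorH1_holds.equiv A 2).symm h)) ^ m) +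
          (⋀[ℂ]^(2 * n) (complexBetti A.X 1)).subtype ((abelianVarietyCohomologyExteriorH1_holds.equiv A (2 * n)).symm cP) +
          (⋀[ℂ]^(2 * n) (complexBetti A.X 1)).subtype ((abelianVarietyCohomologyExteriorH1_holds.equiv A (2 * n)).symm cQ))) +
        2 * (m + 1) * n.choose m = (m + 3) * (n + n).choose m := by
  haveI : Module.Finite ℂ (complexBetti A.X 1) := abelianVarietyCohomologyExteriorH1_holds.finite_one A
  have h := finrank_S_weilType_deg hA hdim hd hφ hP hQ hp hh h11 hvol hcP hcP0 hcQ hcQ0 q hm1 hmn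
  rw [Mod4.hankel1_rank_leading hmn hq0 hqn] at h
  have e1 : (n.choose m + n.choose m) * (m + 1) = 2 * (m + 1) * n.choose m := by ring
  have e2 : (n + n).choose m + (n + n).choose m + (n + n).choose m * (m + 1) = (m + 3) * (n + n).choose m := by ring
  omega

/-- **Mukai density of the carrier ∕ design rows on the real carrier** (`n ≥ 1`): for `q_m = 0` (`1 ≤ m ≤ n − 1`) and the pin
`(2n)!·(ĉ₊ĉ₋) = t·ĥ^{2n}`, the degree-`4n` part of `x^∨ · x` is `((2 q_0 q_{2n} + (-1)ⁿ C(2n,n) q_n² + 2(-1)ⁿ t)/(2n)!) · ĥ^{2n}`.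
[cite: MumfordAV1970, §16] [cite: BuchweitzFlenner2008HH, Prop. 6.4.4] -/
theorem proj_mukaiDual_mul_top_leading (hA : IsSmoothProjective A.dim A.X) {n d : ℕ} (hdim : A.dim = n + n) (hd : 0 < d)
    {φ : A ⟶ A} (hφ : φ ≫ φ = -(d • 𝟙 A)) {P Q : Submodule ℂ (complexBetti A.X 1)}
    (hP : P = Module.End.eigenspace (complexBetti.map φ.hom.hom.hom 1).hom (Complex.I * (Real.sqrt d : ℂ)))
    (hQ : Q = Module.End.eigenspace (complexBetti.map φ.hom.hom.hom 1).hom (-(Complex.I * (Real.sqrt d : ℂ))))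
    (hp : finrank ℂ ↥(P ⊓ hodgeOneZero hA) = n) {h : complexBetti A.X 2}
    (hh : complexBetti.map φ.hom.hom.hom 2 h = (d : ℂ) • h) (h11 : IsOfHodgeType A.dim A.X 2 1 1 h)
    (hvol : ((⋀[ℂ]^2 (complexBetti A.X 1)).subtype ((abelianVarietyCohomologyExteriorH1_holds.equiv A 2).symm h)) ^ (n + n) ≠ 0)
    {cP cQ : complexBetti A.X (2 * n)} (hcP : cP ∈ weilClassesPlus A φ n d) (hcP0 : cP ≠ 0)
    (hcQ : cQ ∈ weilClassesMinus A φ n d) (hcQ0 : cQ ≠ 0) (hn : 1 ≤ n)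
    {q : ℕ → ℂ} (hq0 : ∀ m, 1 ≤ m → m < n → q m = 0) {t : ℂ}
    (ht : (((n + n).factorial : ℕ) : ℂ) •
        ((⋀[ℂ]^(2 * n) (complexBetti A.X 1)).subtype ((abelianVarietyCohomologyExteriorH1_holds.equiv A (2 * n)).symm cP) *
          (⋀[ℂ]^(2 * n) (complexBetti A.X 1)).subtype ((abelianVarietyCohomologyExteriorH1_holds.equiv A (2 * n)).symm cQ)) =
      t • ((⋀[ℂ]^2 (complexBetti A.X 1)).subtype ((abelianVarietyCohomologyExteriorH1_holds.equiv A 2).symm h)) ^ (n + n)) :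
    GradedAlgebra.proj (fun i : ℕ => ⋀[ℂ]^i (complexBetti A.X 1)) ((n + n) + (n + n))
        (((∑ m ∈ Finset.range (n + n + 1), (((-1 : ℂ) ^ m * q m) * ((m.factorial : ℕ) : ℂ)⁻¹) •
              ((⋀[ℂ]^2 (complexBetti A.X 1)).subtype ((abelianVarietyCohomologyExteriorH1_holds.equiv A 2).symm h)) ^ m) +
            (-1 : ℂ) ^ n •
              ((⋀[ℂ]^(2 * n) (complexBetti A.X 1)).subtype ((abelianVarietyCohomologyExteriorH1_holds.equiv A (2 * n)).symm cP) +
                (⋀[ℂ]^(2 * n) (complexBetti A.X 1)).subtype ((abelianVarietyCohomologyExteriorH1_holds.equiv A (2 * n)).symm cQ))) *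
          ((∑ m ∈ Finset.range (n + n + 1), (q m * ((m.factorial : ℕ) : ℂ)⁻¹) •
              ((⋀[ℂ]^2 (complexBetti A.X 1)).subtype ((abelianVarietyCohomologyExteriorH1_holds.equiv A 2).symm h)) ^ m) +
            (⋀[ℂ]^(2 * n) (complexBetti A.X 1)).subtype ((abelianVarietyCohomologyExteriorH1_holds.equiv A (2 * n)).symm cP) +
            (⋀[ℂ]^(2 * n) (complexBetti A.X 1)).subtype ((abelianVarietyCohomologyExteriorH1_holds.equiv A (2 * n)).symm cQ))) =
      (((2 * (q 0 * q (n + n)) + (-1 : ℂ) ^ n * (((n + n).choose n : ℕ) : ℂ) * (q n * q n)) + 2 * ((-1 : ℂ) ^ n * t)) *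
          ((((n + n).factorial : ℕ) : ℂ)⁻¹)) •
        ((⋀[ℂ]^2 (complexBetti A.X 1)).subtype ((abelianVarietyCohomologyExteriorH1_holds.equiv A 2).symm h)) ^ (n + n) := by
  rw [proj_mukaiDual_mul_top_weilType hA hdim hd hφ hP hQ hp hh h11 hvol hcP hcP0 hcQ hcQ0 hn q ht, Mod4.mukaiP_leading hn hq0]

end RealCarrier

end Summit.Ventures.HSemireg.WeilFrame

end
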